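import Literature.Geometry.DiscreteGeometry.ThreePointKernelDimThree
import HarnessLib

/-!
# Bachoc–Vallentin's semidefinite bound for codes in spherical caps of `S²` (polynomial form, `n = 3`)

For a fixed unit vector `e ∈ ℝ³` ("cap centre") the Bachoc–Vallentin matrices `Y_k^n(e·x, e·y, x·y)`
are positive semidefinite kernels in `(x, y)` (property (pos Y), [BachocVallentin2009, Theorem 2.2]);
on `S²` their zonal factor is the homogeneous Chebyshev kernel `Q3 k` of
`Literature.Geometry.DiscreteGeometry.ThreePointKernelDimThree`, whose fixed-pole positivity is the
tree's `BachocVallentin.sum_sum_Q3_nonneg`. This file draws the consequence for codes in caps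
(the polynomial restatement [BachocVallentin2009, Theorem 4.4], case `n = 3`), in the FACTORED
form in which certificates are written: a kernel
`F(u,v,t) = Σ_{k<K} Σ_{r<R} g_{k,r}(u) g_{k,r}(v) Q3 k (u,v,t)` (i.e. `F = Σ_k ⟨F_k, Y_k⟩` with
`F_k = Σ_r g_{k,r} g_{k,r}ᵀ ⪰ 0`, any real functions `g_{k,r}`) satisfies
`Σ_{x,y ∈ C} F(e·x, e·y, x·y) ≥ 0` for every finite `C ⊂ S²`; hence if
(I) `F(u,u,1) ≤ D` for `u ∈ [u₀, 1]` and (II) `F(u,v,t) ≤ -λ` (`λ > 0`) on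
`Δ = {u, v ∈ [u₀,1], t ∈ [-1,s], 1 + 2uvt - u² - v² - t² ≥ 0}`, then every code `C` in the cap
`{x : e·x ≥ u₀}` with pairwise inner products `≤ s` has `(|C| - 1)·λ ≤ D`, so `|C| ≤ N` as soon as
`D < N·λ` (Theorem 4.4 with `F + λ`, `f₀ = λ`, `B = D + λ`: `|C| ≤ B/f₀ = 1 + D/λ`).

* `capKernel3` — the factored kernel;
* `sum_sum_capKernel3_nonneg` — (pos Y) for it around a fixed centre;
* `sub_one_mul_le_of_capKernel3`, `card_le_of_capKernel3` — the bound (real and integer forms);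
* `Q3_diag` — on the diagonal `Q3 k u u 1 = (1 - u²)^k`;
* `CapCert` — a kernel-evaluable certificate FORMAT (rational data: cap level `u₀`, a polynomial row
  basis `W k i` and lower-triangular factors `L k` of the PSD blocks `F_k = L_k L_kᵀ`, as lists of
  rationals), its real semantics `CapCert.g`, `CapCert.kernel = capKernel3 …`, the two polynomial
  inequalities `CapCert.IneqI D` / `CapCert.IneqII s λ` a certificate must come with, and the bound
  `CapCert.card_le` (so that a summit-side user only has to discharge (I) and (II) for explicit data).

Design: the domain `Δ` is taken as the full box `[u₀,1]²` (not the printed half `u ≤ v`), which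
only weakens what a user must supply when `F` is symmetric; no polynomial structure of the `g_{k,r}`
is assumed in the theorems (the printed Gegenbauer row basis is one admissible choice; `CapCert`
carries an arbitrary polynomial basis as data). What is NOT here: the primal SDP, duality, numerical
certificates and their polynomial-inequality checks (instantiated summit-side), dimensions `n ≥ 4`.

## References
* C. Bachoc, F. Vallentin, *Semidefinite programming, multivariate orthogonal polynomials, and codes
  in spherical caps*, European J. Combin. 30 (2009) 625–637, Theorem 2.2, §3 (domain `Δ`),
  Theorem 4.4. [`BachocVallentin2009`]
* C. Bachoc, F. Vallentin, J. Amer. Math. Soc. 21 (2008), Corollary 3.5 (n = 3). [`BachocVallentin2007`]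
-/

noncomputable section

open Finset
open scoped RealInnerProductSpace

namespace Literature.Geometry.DiscreteGeometry

namespace BachocVallentin

open Literature.Analysis.SpecialFunctions

/-- The cap kernel of a factored certificate on `S²`:
`capKernel3 K R g u v t = Σ_{k<K} Σ_{r<R} g k r u · g k r v · Q3 k u v t`
(`= Σ_k ⟨F_k, Y_k(u,v,t)⟩` with `F_k = Σ_r g_{k,r} g_{k,r}ᵀ`, up to the positive normalisation of
`Y_k`). [cite: BachocVallentin2009, Theorem 4.4 (the polynomial F = Σ_k ⟨F_k, Y_k^n⟩, n = 3)] -/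
def capKernel3 (K R : ℕ) (g : ℕ → ℕ → ℝ → ℝ) (u v t : ℝ) : ℝ :=
  ∑ k ∈ range K, ∑ r ∈ range R, g k r u * g k r v * Q3 k u v t

/-- **(pos Y) for a factored cap kernel around a fixed centre (`n = 3`)**: for a unit vector `e`,
a finite set `C` of unit vectors of `ℝ³` and any `g`,
`Σ_{x,y ∈ C} capKernel3 K R g (e·x) (e·y) (x·y) ≥ 0`. [cite: BachocVallentin2009, Theorem 2.2] -/
theorem sum_sum_capKernel3_nonneg (K R : ℕ) (g : ℕ → ℕ → ℝ → ℝ)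
    (e : EuclideanSpace ℝ (Fin 3)) (he : ‖e‖ = 1)
    (C : Finset (EuclideanSpace ℝ (Fin 3))) (hC : ∀ x ∈ C, ‖x‖ = 1) :
    0 ≤ ∑ x ∈ C, ∑ y ∈ C,
      capKernel3 K R g (inner ℝ e x) (inner ℝ e y) (inner ℝ x y) := by
  classical
  -- each `(k, r)` term is a fixed-pole `Q3` sum with weights `c_x = g k r (e·x)`
  have hkr : ∀ k r : ℕ, 0 ≤ ∑ x ∈ C, ∑ y ∈ C,
      g k r (inner ℝ e x) * g k r (inner ℝ e y) *
        Q3 k (inner ℝ e x) (inner ℝ e y) (inner ℝ x y) :=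
    fun k r => sum_sum_Q3_nonneg k e he C (fun x => g k r (inner ℝ e x)) (fun x => x) hC
  -- move the `(k, r)` sums outside
  have hswap : ∑ x ∈ C, ∑ y ∈ C,
      capKernel3 K R g (inner ℝ e x) (inner ℝ e y) (inner ℝ x y) =
      ∑ k ∈ range K, ∑ r ∈ range R, ∑ x ∈ C, ∑ y ∈ C,
        g k r (inner ℝ e x) * g k r (inner ℝ e y) *
          Q3 k (inner ℝ e x) (inner ℝ e y) (inner ℝ x y) := by
    unfold capKernel3
    calc ∑ x ∈ C, ∑ y ∈ C, ∑ k ∈ range K, ∑ r ∈ range R,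
            g k r (inner ℝ e x) * g k r (inner ℝ e y) *
              Q3 k (inner ℝ e x) (inner ℝ e y) (inner ℝ x y)
        = ∑ x ∈ C, ∑ k ∈ range K, ∑ y ∈ C, ∑ r ∈ range R,
            g k r (inner ℝ e x) * g k r (inner ℝ e y) *
              Q3 k (inner ℝ e x) (inner ℝ e y) (inner ℝ x y) :=
          Finset.sum_congr rfl fun x _ => Finset.sum_comm
      _ = ∑ k ∈ range K, ∑ x ∈ C, ∑ y ∈ C, ∑ r ∈ range R,
            g k r (inner ℝ e x) * g k r (inner ℝ e y) *
              Q3 k (inner ℝ e x) (inner ℝ e y) (inner ℝ x y) := Finset.sum_comm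
      _ = ∑ k ∈ range K, ∑ x ∈ C, ∑ r ∈ range R, ∑ y ∈ C,
            g k r (inner ℝ e x) * g k r (inner ℝ e y) *
              Q3 k (inner ℝ e x) (inner ℝ e y) (inner ℝ x y) :=
          Finset.sum_congr rfl fun k _ => Finset.sum_congr rfl fun x _ => Finset.sum_comm
      _ = ∑ k ∈ range K, ∑ r ∈ range R, ∑ x ∈ C, ∑ y ∈ C,
            g k r (inner ℝ e x) * g k r (inner ℝ e y) *
              Q3 k (inner ℝ e x) (inner ℝ e y) (inner ℝ x y) :=
          Finset.sum_congr rfl fun k _ => Finset.sum_comm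
  rw [hswap]
  exact Finset.sum_nonneg fun k _ => Finset.sum_nonneg fun r _ => hkr k r

/-- **Bachoc–Vallentin's cap bound on `S²`, real form:** let `e ∈ ℝ³` be a unit vector and `C` a
nonempty finite set of unit vectors with pairwise inner products `≤ s`, all in the cap
`{x : u₀ ≤ e·x}`. If a factored cap kernel `F = capKernel3 K R g` satisfies
(I) `F(u,u,1) ≤ D` for `u ∈ [u₀,1]` and (II) `F(u,v,t) ≤ -λ` for `u, v ∈ [u₀,1]`, `t ∈ [-1,s]`,
`1 + 2uvt - u² - v² - t² ≥ 0`, with `λ > 0`, then `(|C| - 1)·λ ≤ D`.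
[cite: BachocVallentin2009, Theorem 4.4 (n = 3, with F + λ, f₀ = λ, B = D + λ)] -/
theorem sub_one_mul_le_of_capKernel3 (s u₀ : ℝ) (e : EuclideanSpace ℝ (Fin 3)) (he : ‖e‖ = 1)
    (C : Finset (EuclideanSpace ℝ (Fin 3))) (hC : ∀ x ∈ C, ‖x‖ = 1) (hne : C.Nonempty)
    (hcode : ∀ x ∈ C, ∀ y ∈ C, x ≠ y → inner ℝ x y ≤ s) (hcap : ∀ x ∈ C, u₀ ≤ inner ℝ e x)
    (K R : ℕ) (g : ℕ → ℕ → ℝ → ℝ) (D lam : ℝ)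
    (h1 : ∀ u : ℝ, u₀ ≤ u → u ≤ 1 → capKernel3 K R g u u 1 ≤ D)
    (h2 : ∀ u v t : ℝ, u₀ ≤ u → u ≤ 1 → u₀ ≤ v → v ≤ 1 → -1 ≤ t → t ≤ s →
      0 ≤ 1 + 2 * u * v * t - u ^ 2 - v ^ 2 - t ^ 2 → capKernel3 K R g u v t ≤ -lam) :
    ((C.card : ℝ) - 1) * lam ≤ D := by
  classical
  set F : EuclideanSpace ℝ (Fin 3) → EuclideanSpace ℝ (Fin 3) → ℝ :=
    fun x y => capKernel3 K R g (inner ℝ e x) (inner ℝ e y) (inner ℝ x y) with hF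
  have hS : 0 ≤ ∑ x ∈ C, ∑ y ∈ C, F x y := sum_sum_capKernel3_nonneg K R g e he C hC
  -- the cap coordinates `e·x` lie in `[u₀, 1]`
  have hux : ∀ x ∈ C, u₀ ≤ inner ℝ e x ∧ inner ℝ e x ≤ 1 := by
    intro x hx
    refine ⟨hcap x hx, ?_⟩
    have h := real_inner_le_norm e x
    rw [he, hC x hx, one_mul] at h
    exact h
  -- diagonal terms
  have hdiag : ∀ x ∈ C, F x x ≤ D := by
    intro x hx
    have hxx : inner ℝ x x = (1 : ℝ) := by
      rw [real_inner_self_eq_norm_sq, hC x hx]; norm_num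
    simp only [hF, hxx]
    exact h1 _ (hux x hx).1 (hux x hx).2
  -- off-diagonal terms
  have hoff : ∀ x ∈ C, ∀ y ∈ C, x ≠ y → F x y ≤ -lam := by
    intro x hx y hy hxy
    have hab := abs_real_inner_le_norm x y
    rw [hC x hx, hC y hy, one_mul] at hab
    have ht1 : -1 ≤ inner ℝ x y := (abs_le.1 hab).1
    have hts : inner ℝ x y ≤ s := hcode x hx y hy hxy
    have hg := gram3_nonneg e x y he (hC x hx) (hC y hy)
    exact h2 _ _ _ (hux x hx).1 (hux x hx).2 (hux y hy).1 (hux y hy).2 ht1 hts hg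
  have hcard1 : 1 ≤ C.card := Finset.card_pos.2 hne
  -- each row is at most `D - (|C| - 1) λ`
  have hrow : ∀ x ∈ C, ∑ y ∈ C, F x y ≤ D - ((C.card : ℝ) - 1) * lam := by
    intro x hx
    rw [← Finset.sum_erase_add _ _ hx]
    have hb : ∑ y ∈ C.erase x, F x y ≤ ∑ y ∈ C.erase x, (-lam) :=
      Finset.sum_le_sum fun y hy =>
        hoff x hx y (Finset.mem_of_mem_erase hy) (Finset.ne_of_mem_erase hy).symm
    rw [Finset.sum_const, Finset.card_erase_of_mem hx, nsmul_eq_mul,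
      Nat.cast_sub hcard1, Nat.cast_one] at hb
    linarith [hdiag x hx]
  have htot : ∑ x ∈ C, ∑ y ∈ C, F x y ≤ C.card * (D - ((C.card : ℝ) - 1) * lam) := by
    have h := Finset.sum_le_sum hrow
    rwa [Finset.sum_const, nsmul_eq_mul] at h
  have hcpos : (0 : ℝ) < C.card := by exact_mod_cast hne.card_pos
  by_contra hneg
  push Not at hneg
  have hlt : (C.card : ℝ) * (D - ((C.card : ℝ) - 1) * lam) < 0 :=
    mul_neg_of_pos_of_neg hcpos (by linarith)
  linarith

/-- **Bachoc–Vallentin's cap bound on `S²`, integer form:** under the hypotheses of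
`sub_one_mul_le_of_capKernel3` (for any finite `C`, possibly empty), if moreover `D < N·λ` then
`|C| ≤ N` — i.e. `A(3, θ, φ) ≤ N` for `s = cos θ`, `u₀ = cos φ`; this is how a certificate
`⌊1 + D/λ⌋ = N` is read. [cite: BachocVallentin2009, Theorem 4.4 (n = 3)] -/
theorem card_le_of_capKernel3 (s u₀ : ℝ) (e : EuclideanSpace ℝ (Fin 3)) (he : ‖e‖ = 1)
    (C : Finset (EuclideanSpace ℝ (Fin 3))) (hC : ∀ x ∈ C, ‖x‖ = 1)
    (hcode : ∀ x ∈ C, ∀ y ∈ C, x ≠ y → inner ℝ x y ≤ s) (hcap : ∀ x ∈ C, u₀ ≤ inner ℝ e x)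
    (K R : ℕ) (g : ℕ → ℕ → ℝ → ℝ) (D lam : ℝ) (hlam : 0 < lam)
    (h1 : ∀ u : ℝ, u₀ ≤ u → u ≤ 1 → capKernel3 K R g u u 1 ≤ D)
    (h2 : ∀ u v t : ℝ, u₀ ≤ u → u ≤ 1 → u₀ ≤ v → v ≤ 1 → -1 ≤ t → t ≤ s →
      0 ≤ 1 + 2 * u * v * t - u ^ 2 - v ^ 2 - t ^ 2 → capKernel3 K R g u v t ≤ -lam)
    (N : ℕ) (hN : D < N * lam) : C.card ≤ N := by
  rcases C.eq_empty_or_nonempty with h | hne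
  · simp [h]
  have hmain := sub_one_mul_le_of_capKernel3 s u₀ e he C hC hne hcode hcap K R g D lam h1 h2
  by_contra hlt
  push Not at hlt
  have hle : (N : ℝ) + 1 ≤ C.card := by exact_mod_cast hlt
  have h3 : ((C.card : ℝ) - 1) * lam < N * lam := lt_of_le_of_lt hmain hN
  have h4 : (C.card : ℝ) - 1 < N := lt_of_mul_lt_mul_right h3 hlam.le
  linarith

/-! ### The diagonal of the zonal kernel -/

/-- On the diagonal the homogeneous Chebyshev kernel is a power: `chebHom k (2a) (a²) = a^k`
(`T_k(1) = 1`). [folklore] -/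
private theorem chebHom_two_mul_sq (k : ℕ) (a : ℝ) : chebHom k (2 * a) (a ^ 2) = a ^ k := by
  induction k using Nat.strong_induction_on with
  | _ k ih =>
    match k with
    | 0 => simp [chebHom]
    | 1 => simp [chebHom]
    | k + 2 =>
      have h1 := ih (k + 1) (by omega)
      have h0 := ih k (by omega)
      rw [show chebHom (k + 2) (2 * a) (a ^ 2) =
          2 * a * chebHom (k + 1) (2 * a) (a ^ 2) - a ^ 2 * chebHom k (2 * a) (a ^ 2) from rfl, h1, h0]
      ring

/-- `Q3 k u u 1 = (1 - u²)^k`: the zonal factor on the diagonal `(u, u, 1)` (the point `x = y`).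
[cite: BachocVallentin2009, Theorem 2.1 (Q_k^{n-1}(u,u,1) = (1-u²)^k P_k(1))] -/
theorem Q3_diag (k : ℕ) (u : ℝ) : Q3 k u u 1 = (1 - u ^ 2) ^ k := by
  unfold Q3
  rw [show (2 : ℝ) * (1 - u * u) = 2 * (1 - u ^ 2) by ring,
    show (1 - u ^ 2) * (1 - u ^ 2) = (1 - u ^ 2) ^ 2 by ring]
  exact chebHom_two_mul_sq k (1 - u ^ 2)

/-! ### A kernel-evaluable certificate format -/

/-- Real value of a univariate rational coefficient list (lowest degree first):
`upolyEval [c₀, c₁, …] u = c₀ + c₁ u + …` (Horner). [folklore] -/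
def upolyEval : List ℚ → ℝ → ℝ
  | [], _ => 0
  | c :: cs, u => (c : ℝ) + u * upolyEval cs u

/-- A CAP CERTIFICATE in factored form (the data a solver hands over, all rational): the cap level
`u₀`, a column bound `R`, for each block `k` (list position) a polynomial ROW BASIS `W k = [w_{k,0}, w_{k,1}, …]`
(coefficient lists) and a factor `L k` (rows `i`, columns `r`) of the positive semidefinite block
`F_k = L_k L_kᵀ`. Positive semidefiniteness is thus BY CONSTRUCTION; nothing else is claimed by the
data. [cite: BachocVallentin2009, Theorem 4.4 (the matrices F_k ⪰ 0 of a feasible polynomial)] -/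
structure CapCert where
  /-- cap level `u₀ = cos φ` -/
  u0 : ℚ
  /-- a bound on the number of columns of every factor `L k` -/
  R : ℕ
  /-- row bases: `W[k][i]` = coefficient list of `w_{k,i}` -/
  W : List (List (List ℚ))
  /-- factors: `L[k][i][r]` -/
  L : List (List (List ℚ))

namespace CapCert

/-- Entry `L_k[i][r]` (zero outside the stored range). [folklore] -/
def entry (c : CapCert) (k i r : ℕ) : ℚ := ((c.L.getD k []).getD i []).getD r 0

/-- Basis polynomial `w_{k,i}` (zero outside the stored range). [folklore] -/
def basis (c : CapCert) (k i : ℕ) : List ℚ := (c.W.getD k []).getD i []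

/-- Number of rows of block `k`. [folklore] -/
def rows (c : CapCert) (k : ℕ) : ℕ := (c.L.getD k []).length

/-- The column functions `g_{k,r}(u) = Σ_i L_k[i][r] · w_{k,i}(u)` (so that
`Σ_r g_{k,r}(u) g_{k,r}(v) = w_k(u)ᵀ L_k L_kᵀ w_k(v)`). [cite: BachocVallentin2009, Theorem 4.4] -/
def g (c : CapCert) (k r : ℕ) (u : ℝ) : ℝ :=
  ∑ i ∈ range (c.rows k), (c.entry k i r : ℝ) * upolyEval (c.basis k i) u

/-- The certificate's kernel `K(u,v,t) = Σ_k Q3 k (u,v,t) · w_k(u)ᵀ L_k L_kᵀ w_k(v)`, as a factored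
cap kernel. [cite: BachocVallentin2009, Theorem 4.4] -/
def kernel (c : CapCert) (u v t : ℝ) : ℝ := capKernel3 c.L.length c.R c.g u v t

/-- Inequality (I) («(d)» in the source): `K(u,u,1) ≤ D` on `[u₀, 1]`.
[cite: BachocVallentin2009, Theorem 4.4 (d)] -/
def IneqI (c : CapCert) (D : ℚ) : Prop :=
  ∀ u : ℝ, (c.u0 : ℝ) ≤ u → u ≤ 1 → c.kernel u u 1 ≤ D

/-- Inequality (II) («(c)» in the source, for `F = K + λ`): `K(u,v,t) ≤ -λ` for `u, v ∈ [u₀, 1]`,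
`t ∈ [-1, s]`, `1 + 2uvt - u² - v² - t² ≥ 0`. [cite: BachocVallentin2009, Theorem 4.4 (c), §3 (Δ)] -/
def IneqII (c : CapCert) (s lam : ℚ) : Prop :=
  ∀ u v t : ℝ, (c.u0 : ℝ) ≤ u → u ≤ 1 → (c.u0 : ℝ) ≤ v → v ≤ 1 → -1 ≤ t → t ≤ s →
    0 ≤ 1 + 2 * u * v * t - u ^ 2 - v ^ 2 - t ^ 2 → c.kernel u v t ≤ -lam

/-- **What a checked cap certificate proves** (`n = 3`): if `c` satisfies (I) with `D` and (II) with
`s, λ`, `λ > 0` and `D < N·λ`, then every finite set of unit vectors of `ℝ³` with pairwise inner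
products `≤ s` inside a cap `{x : u₀ ≤ e·x}` (`e` a unit vector) has at most `N` elements.
[cite: BachocVallentin2009, Theorem 4.4 (n = 3)] -/
theorem card_le (c : CapCert) (s lam D : ℚ) (N : ℕ) (hlam : 0 < lam) (hN : D < N * lam)
    (h1 : c.IneqI D) (h2 : c.IneqII s lam)
    (e : EuclideanSpace ℝ (Fin 3)) (he : ‖e‖ = 1)
    (C : Finset (EuclideanSpace ℝ (Fin 3))) (hC : ∀ x ∈ C, ‖x‖ = 1)
    (hcode : ∀ x ∈ C, ∀ y ∈ C, x ≠ y → inner ℝ x y ≤ s) (hcap : ∀ x ∈ C, (c.u0 : ℝ) ≤ inner ℝ e x) :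
    C.card ≤ N := by
  have hlam' : (0 : ℝ) < lam := by exact_mod_cast hlam
  have hN' : (D : ℝ) < (N : ℝ) * lam := by exact_mod_cast hN
  exact card_le_of_capKernel3 s c.u0 e he C hC hcode hcap c.L.length c.R c.g D lam hlam'
    h1 h2 N hN'

/-- The diagonal of a certificate's kernel in closed form:
`K(u,u,1) = Σ_k (1 - u²)^k Σ_r g_{k,r}(u)²`. [cite: BachocVallentin2009, Theorem 2.1] -/
theorem kernel_diag (c : CapCert) (u : ℝ) :
    c.kernel u u 1 = ∑ k ∈ range c.L.length, (1 - u ^ 2) ^ k * ∑ r ∈ range c.R, c.g k r u ^ 2 := by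
  unfold kernel capKernel3
  refine Finset.sum_congr rfl fun k _ => ?_
  rw [Finset.mul_sum]
  refine Finset.sum_congr rfl fun r _ => ?_
  rw [Q3_diag]; ring

end CapCert

end BachocVallentin

end Literature.Geometry.DiscreteGeometry
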